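import Literature.NumberTheory.EllipticCurves.Sprung2012.LocalTowerNoPTorsionProofs
import Summits.BirchSwinnertonDyer.Rank1Residual.P2.EmptyCellsAtTwo
import HarnessLib

/-!
# Sprung 2012, Lemma 2.3 AT `p = 2`: `E(ℚ_∞·ℚ₂)` has no `2`-torsion at a good supersingular `2`
# (Greenberg's fixed-point principle, `p`-uniform, + `E(ℚ₂)[2] = 0` from the `2`-division cubic)

Seat `bsd-2adic-ss-1` GEN 10, crux `SupersingularRankZeroAtTwo` (item stmt-BirchSwinnertonDyer-19097,
route `ByReductionTypeAtTwo`, rung K4), line `signed_halves_two` stub (5) `stub_pmFlatData` — the `p = 2`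
port of the ♭ `Γ`-Euler characteristic (parts 1–3: `…FlatColemanClauses`, `…FlatLocalInjectivity`,
`…FlatEulerCharRat`) displays "no `2`-torsion in `E(ℚ_∞·ℚ₂)`" (F. Sprung, J. Number Theory 132 (2012)
Lemma 2.3 "`F_ss(k_n)` has no `p`-torsion", §2 p. 1486 "we included the prime `p = 2`"); the tree's
discharge `Sprung2012.lem23_localTowerPoints_noPTorsion_holds` is typed `p ≠ 2` because its bottom step
`E(ℚ_p)[p] = 0` goes through Silverman IV.6.1 (`p ≥ 3`). This file discharges it AT `2`.

WHAT IS PROVED (`W/ℚ` elliptic, globally minimal):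
* §1 (`p`-uniform, ANY prime `p`, any `ℤ_p`-extension `κ` of `ℚ`, any embedding `ι : ℚ̄ → K̄_v`,
  `v ∋ p`): `eq_zero_of_mem_localTowerPointsOfEmb_of_prime_nsmul_of_base` — IF `E(ℚ_v)[p] = 0` THEN
  `E(ℚ_∞·ℚ_v)[p] = 0`. Greenberg's fixed-point principle exactly as in the K3 lane's file (LNM 1716,
  proof of Prop. 4.8, p. 109: a pro-`p` group acting on a non-zero finite `p`-group has a non-zero fixed
  point; `ZpExtension.isPGroup_range_of_localSubgroupOfEmb_le`), with the bottom step displayed as a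
  hypothesis instead of bought from Silverman IV.6.1 — proof body adapted from
  `Sprung2012.eq_zero_of_mem_localTowerPointsOfEmb_of_prime_nsmul` (credit: `bsd-cited-r18`).
* §2 (`p = 2`): `two_nsmul_eq_zero_padic_of_goodSS_two` — **`E(ℚ₂)[2] = 0` at a good SUPERSINGULAR `2`**:
  a `ℚ₂`-point `(x, y)` with `2·(x, y) = O` has `x` a root of the `2`-division cubic
  `4x³ + b₂x² + 2b₄x + b₆`, and on the minimal model good supersingular reduction at `2` forces `4 ∣ b₂`,
  `2 ∣ b₄`, `b₆` odd (`Rank1Residual.P2.b_parity_of_goodSS_two`); `2`-adically: if `|x|₂ ≤ 1` the cubic is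
  `≡ b₆ ≡ 1 (mod 2)`, if `|x|₂ > 1` then after multiplying by `x⁻³` it is `4 + (small of norm ≤ 1/8)`;
  either way non-zero. (The LOCAL twin of `Rank1Residual.P2.not_red_two_of_goodSS_two`; equivalently the
  height-`2` formal group has no `ℚ₂`-rational `2`-torsion and `#Ẽ(𝔽₂) ∈ {1, 3, 5}` is odd.)
* §3: `eq_zero_of_mem_localTowerPointsOfEmb_of_two_nsmul` — **Lemma 2.3 at `2`**: for `GoodSS W 2`, any
  `ℤ₂`-extension `κ` of `ℚ`, `v ∋ 2`, any `ι`, every `P ∈ E(ℚ_∞·ℚ_v)` with `2 • P = O` is `O`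
  (§1 + §2 + the transport `E(ℚ_v)[n] = 0 ⟺ E(ℚ_2)[n] = 0`, `forall_nsmul_eq_zero_adicCompletion_iff_padic`).
HONEST FRAMING: a local torsion statement; nothing about any census cell; BSD is not proved by any of this.

References: [Sprung2012] Lemma 2.3 (p. 1487), §2 p. 1486, proof of Prop. 7.3 (p. 1500);
[GreenbergLNM1716] proof of Prop. 4.8 (p. 109); [SilvermanAEC2009] III.2.3 (negation, `ψ₂`), VII.2–VII.3.
-/

set_option autoImplicit false
-- the Theorems namespace of this sub repeats the summit name by design (D-0017 nested layout)
set_option linter.dupNamespace false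

noncomputable section

open scoped Classical NumberField AddSubgroup

open NumberField IsDedekindDomain WeierstrassCurve Literature.NumberTheory.EllipticCurves
  Literature.NumberTheory.EllipticCurves.ZpExtension Literature.NumberTheory.EllipticCurves.Sprung2012
  Literature.NumberTheory.EllipticCurves.Rank1Residual

universe u

namespace Summit.BirchSwinnertonDyer.BirchSwinnertonDyer.Theorems.SSFlatEC

variable (W : WeierstrassCurve ℚ) [W.IsElliptic] [W.IsGloballyMinimal] (p : ℕ) [Fact p.Prime]
  {v : HeightOneSpectrum (𝓞 ℚ)}

/-! ## §1 Greenberg's fixed-point principle, `p`-uniform: `E(ℚ_v)[p] = 0 ⟹ E(ℚ_∞·ℚ_v)[p] = 0` -/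

omit [W.IsElliptic] [W.IsGloballyMinimal] [Fact p.Prime] in
/-- **`E(K̄_v)^{Γ_{ℚ_v}}[p] = E(ℚ_v)[p]`** (Galois descent): IF `E(ℚ_v)[p] = 0` (displayed, `hv0`) THEN a
point of `E(K̄_v)` fixed by all of `Γ_{ℚ_v}` and killed by `p` is `O`. Any prime `p`. The body of
`Sprung2012.localPoints_eq_zero_of_forall_smul_eq_of_prime_nsmul` with its Silverman step displayed.
[cite: Sprung2012, Lemma 2.3 (p. 1487) and proof of Prop. 7.3 (p. 1500)] -/
theorem localPoints_eq_zero_of_forall_smul_eq_of_prime_nsmul_of_base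
    (hv0 : ∀ Q : (W.baseChange (v.adicCompletion ℚ)).toAffine.Point, p • Q = 0 → Q = 0)
    {P : localPoints W (v.adicCompletion ℚ)}
    (hfix : ∀ σ : Field.absoluteGaloisGroup (v.adicCompletion ℚ), σ • P = P) (hpP : p • P = 0) :
    P = 0 := by
  haveI : PerfectField (v.adicCompletion ℚ) := by
    haveI : CharZero (v.adicCompletion ℚ) :=
      charZero_of_injective_algebraMap (algebraMap ℚ _).injective
    infer_instance
  set Q : geomPoints (W.baseChange (v.adicCompletion ℚ)) :=
    localPointsEquivBaseChange W (v.adicCompletion ℚ) P with hQdef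
  have hQ : ∀ σ : Field.absoluteGaloisGroup (v.adicCompletion ℚ), σ • Q = Q := fun σ ↦ by
    rw [hQdef, ← localPointsEquivBaseChange_smul W (v.adicCompletion ℚ) σ P, hfix σ]
  obtain ⟨P₀, hP₀⟩ :=
    WeierstrassCurve.exists_toGeomPoints_eq_of_forall_smul_eq (W.baseChange (v.adicCompletion ℚ)) hQ
  have hP₀p : p • P₀ = 0 := by
    apply WeierstrassCurve.toGeomPoints_injective (W.baseChange (v.adicCompletion ℚ))
    rw [map_nsmul, hP₀, map_zero, hQdef, ← map_nsmul, hpP, map_zero]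
  have hP₀0 : P₀ = 0 := hv0 P₀ hP₀p
  have hQ0 : Q = 0 := by rw [← hP₀, hP₀0, map_zero]
  exact (localPointsEquivBaseChange W (v.adicCompletion ℚ)).injective (by rw [← hQdef, hQ0, map_zero])

omit [W.IsGloballyMinimal] in
/-- **`E(ℚ_v)[p] = 0 ⟹ E(ℚ_∞·ℚ_v)[p] = 0`, for ANY prime `p`, any `ℤ_p`-extension `κ` of `ℚ` and any
embedding `ι : ℚ̄ → K̄_v`** — Greenberg's fixed-point principle: `V = E(ℚ_∞·ℚ_v)[p]` is a finite `p`-group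
on which `Γ_{ℚ_v}` acts through a `p`-group (`isPGroup_range_of_localSubgroupOfEmb_le`), its fixed points
lie in `E(ℚ_v)[p] = 0`, so `#V ≡ 1 (mod p)` and `V = 0`. The body of
`Sprung2012.eq_zero_of_mem_localTowerPointsOfEmb_of_prime_nsmul` with the bottom step displayed (`hv0`).
[cite: Sprung2012, Lemma 2.3 (p. 1487)] [cite: GreenbergLNM1716, proof of Prop. 4.8 (p. 109)] -/
theorem eq_zero_of_mem_localTowerPointsOfEmb_of_prime_nsmul_of_base
    (hv0 : ∀ Q : (W.baseChange (v.adicCompletion ℚ)).toAffine.Point, p • Q = 0 → Q = 0)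
    (κ : ZpExtension ℚ p) (ι : AlgebraicClosure ℚ →ₐ[ℚ] AlgebraicClosure (v.adicCompletion ℚ))
    {P : localPoints W (v.adicCompletion ℚ)} (hPmem : P ∈ localTowerPointsOfEmb κ ι W)
    (hpP : p • P = 0) : P = 0 := by
  have hp : p.Prime := Fact.out
  set V : AddSubgroup (localPoints W (v.adicCompletion ℚ)) :=
    localTowerPointsOfEmb κ ι W ⊓ (localPoints W (v.adicCompletion ℚ))[(p : ℕ)] with hV
  have hpne : ((p : ℕ) : AlgebraicClosure (v.adicCompletion ℚ)) ≠ 0 := by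
    haveI : CharZero (v.adicCompletion ℚ) :=
      charZero_of_injective_algebraMap (algebraMap ℚ _).injective
    exact_mod_cast hp.ne_zero
  have hcard : Nat.card ((localPoints W (v.adicCompletion ℚ))[(p : ℕ)]) = p ^ 2 :=
    WeierstrassCurve.card_torsionPoints_eq_sq_holds W (AlgebraicClosure (v.adicCompletion ℚ))
      (n := p) hpne
  have hfinp : Finite ↥((localPoints W (v.adicCompletion ℚ))[(p : ℕ)]) :=
    Nat.finite_of_card_ne_zero (by rw [hcard]; exact pow_ne_zero 2 hp.ne_zero)
  haveI hVfin : Finite V :=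
    Finite.of_injective _ (AddSubgroup.inclusion_injective (inf_le_right : V ≤ _))
  have hmemV : ∀ {x : localPoints W (v.adicCompletion ℚ)},
      x ∈ V ↔ x ∈ localTowerPointsOfEmb κ ι W ∧ p • x = 0 := by
    intro x
    rw [hV, AddSubgroup.mem_inf, AddSubgroup.torsionBy.nsmul_iff]
  have hstab : ∀ (σ : Field.absoluteGaloisGroup (v.adicCompletion ℚ))
      (x : localPoints W (v.adicCompletion ℚ)), x ∈ V → σ • x ∈ V := by
    intro σ x hx
    rw [hmemV] at hx ⊢
    refine ⟨smul_mem_localTowerPointsOfEmb κ ι W σ hx.1, ?_⟩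
    rw [smul_comm, hx.2, smul_zero]
  let ρ : Field.absoluteGaloisGroup (v.adicCompletion ℚ) →* Equiv.Perm V :=
    { toFun := fun σ ↦
        { toFun := fun x ↦ ⟨σ • (x : localPoints W (v.adicCompletion ℚ)), hstab σ _ x.2⟩
          invFun := fun x ↦ ⟨σ⁻¹ • (x : localPoints W (v.adicCompletion ℚ)), hstab σ⁻¹ _ x.2⟩
          left_inv := fun x ↦
            Subtype.ext (inv_smul_smul σ (x : localPoints W (v.adicCompletion ℚ)))
          right_inv := fun x ↦
            Subtype.ext (smul_inv_smul σ (x : localPoints W (v.adicCompletion ℚ))) }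
      map_one' := Equiv.ext fun x ↦
        Subtype.ext (one_smul _ (x : localPoints W (v.adicCompletion ℚ)))
      map_mul' := fun σ τ ↦ Equiv.ext fun x ↦
        Subtype.ext (mul_smul σ τ (x : localPoints W (v.adicCompletion ℚ))) }
  have hρ : ∀ (σ : Field.absoluteGaloisGroup (v.adicCompletion ℚ)) (x : V),
      ((ρ σ x : V) : localPoints W (v.adicCompletion ℚ)) =
        σ • (x : localPoints W (v.adicCompletion ℚ)) := fun _ _ ↦ rfl
  have hker : localSubgroupOfEmb κ.kerSubgroup ι ≤ ρ.ker := by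
    intro τ hτ
    rw [MonoidHom.mem_ker]
    refine Equiv.ext fun x ↦ Subtype.ext ?_
    rw [hρ, Equiv.Perm.coe_one, id_eq]
    exact (mem_localTowerPointsOfEmb_iff κ ι W _).mp (hmemV.mp x.2).1 τ hτ
  have hP : IsPGroup p ρ.range := κ.isPGroup_range_of_localSubgroupOfEmb_le ι ρ hker
  have hfp : MulAction.fixedPoints ρ.range V = {(0 : V)} := by
    ext x
    simp only [Set.mem_singleton_iff, MulAction.mem_fixedPoints]
    constructor
    · intro hx
      have hall : ∀ σ : Field.absoluteGaloisGroup (v.adicCompletion ℚ),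
          σ • (x : localPoints W (v.adicCompletion ℚ)) =
            (x : localPoints W (v.adicCompletion ℚ)) := fun σ ↦ by
        have h := hx ⟨ρ σ, MonoidHom.mem_range.mpr ⟨σ, rfl⟩⟩
        rw [Subgroup.mk_smul, Equiv.Perm.smul_def] at h
        have h' := congrArg (fun z : V ↦ (z : localPoints W (v.adicCompletion ℚ))) h
        simpa only [hρ] using h'
      have hx0 : (x : localPoints W (v.adicCompletion ℚ)) = 0 :=
        localPoints_eq_zero_of_forall_smul_eq_of_prime_nsmul_of_base W p hv0 hall (hmemV.mp x.2).2
      exact Subtype.ext (by rw [hx0, ZeroMemClass.coe_zero])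
    · rintro rfl ⟨π, hπ⟩
      obtain ⟨σ, rfl⟩ := MonoidHom.mem_range.mp hπ
      rw [Subgroup.mk_smul, Equiv.Perm.smul_def]
      exact Subtype.ext (by rw [hρ, ZeroMemClass.coe_zero, smul_zero])
  have hmod : Nat.card V ≡ 1 [MOD p] := by
    have h := hP.card_modEq_card_fixedPoints V
    have h1 : Nat.card (({0} : Set V) : Type _) = 1 := Nat.card_unique
    rwa [hfp, h1] at h
  have hPV : IsPGroup p (Multiplicative V) := fun g ↦ ⟨1, by
    rw [pow_one]
    change Multiplicative.ofAdd (p • (Multiplicative.toAdd g)) = Multiplicative.ofAdd 0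
    congr 1
    exact Subtype.ext (by
      rw [AddSubmonoidClass.coe_nsmul, ZeroMemClass.coe_zero]
      exact (hmemV.mp (Multiplicative.toAdd g).2).2)⟩
  obtain ⟨n, hn⟩ := IsPGroup.iff_card.mp hPV
  have hnV : Nat.card V = p ^ n := hn
  have hn0 : n = 0 := by
    by_contra hne
    have hdvd : p ∣ Nat.card V := hnV ▸ dvd_pow_self p hne
    have h : Nat.card V % p = 1 % p := hmod
    rw [Nat.mod_eq_zero_of_dvd hdvd, Nat.mod_eq_of_lt hp.one_lt] at h
    exact zero_ne_one h
  rw [hn0, pow_zero] at hnV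
  haveI hsub : Subsingleton V := (Nat.card_eq_one_iff_unique.mp hnV).1
  have hPV' : P ∈ V := hmemV.mpr ⟨hPmem, hpP⟩
  have h := congrArg Subtype.val (Subsingleton.elim (⟨P, hPV'⟩ : V) ⟨0, V.zero_mem⟩)
  exact h

/-! ## §2 `E(ℚ₂)[2] = 0` at a good supersingular `2` -/

omit [W.IsElliptic] [W.IsGloballyMinimal] p in
/-- The `x`-coordinate of a point of order dividing `2` over any field `F` is a root of the `2`-division
cubic `4x³ + b₂x² + 2b₄x + b₆` (the point equals its negative `(x, −y − a₁x − a₃)`, so `2y + a₁x + a₃ = 0`,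
and `(2y + a₁x + a₃)² = 4x³ + b₂x² + 2b₄x + b₆` on the curve; Silverman *AEC* III.2.3). The tree has this
over `ℚ` (`X5.O1.fourCubic_eq_zero_of_two_nsmul_eq_zero`); here over an arbitrary field.
[cite: SilvermanAEC2009, III.2.3] -/
theorem fourCubic_eq_zero_of_two_nsmul_eq_zero_field {F : Type*} [Field F] (V : WeierstrassCurve F)
    {x y : F} {h : V.toAffine.Nonsingular x y} (h2 : (2 : ℕ) • (Affine.Point.some x y h) = 0) :
    4 * x ^ 3 + V.b₂ * x ^ 2 + 2 * V.b₄ * x + V.b₆ = 0 := by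
  rw [two_nsmul, add_eq_zero_iff_eq_neg, Affine.Point.neg_some, Affine.Point.some.injEq] at h2
  have hy := h2.2
  simp only [Affine.negY] at hy
  have hy' : 2 * y + V.a₁ * x + V.a₃ = 0 := by linear_combination hy
  have heq : y ^ 2 + V.a₁ * x * y + V.a₃ * y = x ^ 3 + V.a₂ * x ^ 2 + V.a₄ * x + V.a₆ :=
    (Affine.equation_iff x y).mp h.1
  simp only [WeierstrassCurve.b₂, WeierstrassCurve.b₄, WeierstrassCurve.b₆]
  linear_combination (-4 : F) * heq + (2 * y + V.a₁ * x + V.a₃) * hy'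

omit [W.IsElliptic] [W.IsGloballyMinimal] p in
/-- **The `2`-division cubic has no `2`-adic root when `4 ∣ b₂`, `2 ∣ b₄`, `b₆` odd** (integers
`B₂, B₄, B₆`): if `|x|₂ ≤ 1` then `4x³ + B₂x² + 2B₄x ≡ 0` and `B₆ ≡ 1 (mod 2ℤ₂)`; if `|x|₂ > 1` then
`|x⁻¹|₂ ≤ 1/2` and `4 = −(B₂x⁻¹ + 2B₄x⁻² + B₆x⁻³)` has right side of norm `≤ 1/8 < |4|₂ = 1/4`. [folklore] -/
theorem fourCubic_ne_zero_padic_two {B₂ B₄ B₆ : ℤ} (h₂ : (4 : ℤ) ∣ B₂) (h₄ : (2 : ℤ) ∣ B₄) (h₆ : Odd B₆)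
    (x : ℚ_[2]) : 4 * x ^ 3 + (B₂ : ℚ_[2]) * x ^ 2 + 2 * (B₄ : ℚ_[2]) * x + (B₆ : ℚ_[2]) ≠ 0 := by
  obtain ⟨k, rfl⟩ := h₂
  obtain ⟨m, rfl⟩ := h₄
  obtain ⟨n, rfl⟩ := h₆
  have h2 : ‖(2 : ℚ_[2])‖ = 2⁻¹ := by
    have := Padic.norm_p (p := 2)
    exact_mod_cast this
  have hk : ‖(k : ℚ_[2])‖ ≤ 1 := Padic.norm_int_le_one k
  have hm : ‖(m : ℚ_[2])‖ ≤ 1 := Padic.norm_int_le_one m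
  have hn : ‖(n : ℚ_[2])‖ ≤ 1 := Padic.norm_int_le_one n
  intro hZ
  push_cast at hZ
  by_cases hx : ‖x‖ ≤ 1
  · -- `1 = -2 · (2x³ + 2k x² + 2m x + n)`
    have hT : ‖2 * x ^ 3 + 2 * (k : ℚ_[2]) * x ^ 2 + 2 * (m : ℚ_[2]) * x + (n : ℚ_[2])‖ ≤ 1 := by
      have h1 : ‖2 * x ^ 3‖ ≤ 1 := by
        rw [norm_mul, norm_pow, h2]
        nlinarith [norm_nonneg x, pow_le_one₀ (norm_nonneg x) hx (n := 3)]
      have h2' : ‖2 * (k : ℚ_[2]) * x ^ 2‖ ≤ 1 := by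
        rw [norm_mul, norm_mul, norm_pow, h2]
        nlinarith [norm_nonneg x, norm_nonneg (k : ℚ_[2]), pow_le_one₀ (norm_nonneg x) hx (n := 2)]
      have h3 : ‖2 * (m : ℚ_[2]) * x‖ ≤ 1 := by
        rw [norm_mul, norm_mul, h2]
        nlinarith [norm_nonneg x, norm_nonneg (m : ℚ_[2])]
      refine (Padic.nonarchimedean _ _).trans (max_le ?_ hn)
      refine (Padic.nonarchimedean _ _).trans (max_le ?_ h3)
      exact (Padic.nonarchimedean _ _).trans (max_le h1 h2')
    have e : (1 : ℚ_[2]) =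
        -(2 * (2 * x ^ 3 + 2 * (k : ℚ_[2]) * x ^ 2 + 2 * (m : ℚ_[2]) * x + (n : ℚ_[2]))) := by
      linear_combination hZ
    have h1 : ‖(1 : ℚ_[2])‖ ≤ 2⁻¹ := by
      rw [e, norm_neg, norm_mul, h2]
      nlinarith [norm_nonneg (2 * x ^ 3 + 2 * (k : ℚ_[2]) * x ^ 2 + 2 * (m : ℚ_[2]) * x + (n : ℚ_[2]))]
    rw [norm_one] at h1
    norm_num at h1
  · -- `|x| > 1`: `4 = -(x⁻¹) · (4k + 4m x⁻¹ + (2n+1) x⁻²)` with `|x⁻¹| ≤ 1/2`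
    push Not at hx
    have hx0 : x ≠ 0 := by
      intro h0; rw [h0, norm_zero] at hx; exact absurd hx (by norm_num)
    set t : ℚ_[2] := x⁻¹ with ht
    have htx : t * x = 1 := by rw [ht, inv_mul_cancel₀ hx0]
    have htn : ‖t‖ < 1 := by
      rw [ht, norm_inv]
      exact inv_lt_one_of_one_lt₀ hx
    have htle : ‖t‖ ≤ 2⁻¹ := by
      -- norms on `ℚ_[2]` take values in `2^ℤ ∪ {0}`
      have key : ‖t‖ < (2 : ℝ) ^ ((-1 : ℤ) + 1) → ‖t‖ ≤ (2 : ℝ) ^ (-1 : ℤ) := fun h ↦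
        (Padic.norm_le_pow_iff_norm_lt_pow_add_one t (-1)).mpr h
      have h' : ‖t‖ ≤ (2 : ℝ) ^ (-1 : ℤ) := key (by simpa using htn)
      simpa using h'
    -- multiply the relation by `t³`
    have e : (4 : ℚ_[2]) = -(t * (4 * (k : ℚ_[2]) + 4 * (m : ℚ_[2]) * t + (2 * (n : ℚ_[2]) + 1) * t ^ 2)) := by
      have e3 : t ^ 3 * x ^ 3 = 1 := by rw [← mul_pow, htx, one_pow]
      have e2 : t ^ 2 * x ^ 2 = 1 := by rw [← mul_pow, htx, one_pow]
      linear_combination (t ^ 3) * hZ - 4 * e3 - (4 * (k : ℚ_[2]) * t) * e2 -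
        (4 * (m : ℚ_[2]) * t ^ 2) * htx
    have h4n : ‖(4 : ℚ_[2])‖ = 4⁻¹ := by
      have h' : ‖(4 : ℚ_[2])‖ = ‖(2 : ℚ_[2])‖ ^ 2 := by
        rw [← norm_pow]; norm_num
      rw [h', h2]; norm_num
    have hS : ‖4 * (k : ℚ_[2]) + 4 * (m : ℚ_[2]) * t + (2 * (n : ℚ_[2]) + 1) * t ^ 2‖ ≤ 4⁻¹ := by
      have h1 : ‖4 * (k : ℚ_[2])‖ ≤ 4⁻¹ := by
        rw [norm_mul, h4n]; nlinarith [norm_nonneg (k : ℚ_[2])]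
      have h2' : ‖4 * (m : ℚ_[2]) * t‖ ≤ 4⁻¹ := by
        rw [norm_mul, norm_mul, h4n]
        nlinarith [norm_nonneg (m : ℚ_[2]), norm_nonneg t, mul_nonneg (norm_nonneg (m : ℚ_[2])) (norm_nonneg t)]
      have h3 : ‖(2 * (n : ℚ_[2]) + 1) * t ^ 2‖ ≤ 4⁻¹ := by
        have h21 : ‖2 * (n : ℚ_[2]) + 1‖ ≤ 1 := by
          have := Padic.norm_int_le_one (p := 2) (2 * n + 1)
          exact_mod_cast this
        have ht2 : ‖t‖ ^ 2 ≤ 4⁻¹ := by nlinarith [norm_nonneg t]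
        rw [norm_mul, norm_pow]
        nlinarith [norm_nonneg (2 * (n : ℚ_[2]) + 1), pow_nonneg (norm_nonneg t) 2]
      refine (Padic.nonarchimedean _ _).trans (max_le ?_ h3)
      exact (Padic.nonarchimedean _ _).trans (max_le h1 h2')
    have hle : ‖(4 : ℚ_[2])‖ ≤ 2⁻¹ * 4⁻¹ := by
      rw [e, norm_neg, norm_mul]
      exact mul_le_mul htle hS (norm_nonneg _) (by norm_num)
    rw [h4n] at hle
    norm_num at hle

omit [W.IsElliptic] in
/-- **`E(ℚ₂)[2] = 0` at a good SUPERSINGULAR `2`** (over Mathlib's `ℚ_[2]`): for `W/ℚ` elliptic and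
globally minimal with `GoodSS W 2`, every `Q ∈ E(ℚ₂)` with `2 • Q = O` is `O` — the `x`-coordinate of a
point of order `2` would be a `2`-adic root of `4x³ + b₂x² + 2b₄x + b₆` with `4 ∣ b₂`, `2 ∣ b₄`, `b₆` odd
(`Rank1Residual.P2.b_parity_of_goodSS_two`), impossible (`fourCubic_ne_zero_padic_two`). The level-`0` case
of Sprung 2012 Lemma 2.3 at `p = 2` together with "`Ẽ(𝔽_p)` has no `p`-torsion since `p` is
supersingular" (proof of Prop. 7.3): `#Ẽ(𝔽₂) = 3 − a₂ ∈ {1, 3, 5}`.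
[cite: Sprung2012, Lemma 2.3 (p. 1487) and proof of Prop. 7.3 (p. 1500)] [cite: SilvermanAEC2009, III.2.3] -/
theorem two_nsmul_eq_zero_padic_of_goodSS_two (hss : GoodSS W 2)
    (Q : (W.baseChange ℚ_[2]).toAffine.Point) (h2Q : 2 • Q = 0) : Q = 0 := by
  obtain ⟨p2, p4, p6⟩ := Summit.BirchSwinnertonDyer.Rank1Residual.P2.b_parity_of_goodSS_two W hss
  have hb₂ : (W.baseChange ℚ_[2]).b₂ = ((integralModelInt W).b₂ : ℚ_[2]) := by
    have h := congrArg WeierstrassCurve.b₂ (map_integralModelInt W)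
    rw [WeierstrassCurve.map_b₂] at h
    rw [WeierstrassCurve.baseChange, WeierstrassCurve.map_b₂, ← h]
    simp
  have hb₄ : (W.baseChange ℚ_[2]).b₄ = ((integralModelInt W).b₄ : ℚ_[2]) := by
    have h := congrArg WeierstrassCurve.b₄ (map_integralModelInt W)
    rw [WeierstrassCurve.map_b₄] at h
    rw [WeierstrassCurve.baseChange, WeierstrassCurve.map_b₄, ← h]
    simp
  have hb₆ : (W.baseChange ℚ_[2]).b₆ = ((integralModelInt W).b₆ : ℚ_[2]) := by
    have h := congrArg WeierstrassCurve.b₆ (map_integralModelInt W)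
    rw [WeierstrassCurve.map_b₆] at h
    rw [WeierstrassCurve.baseChange, WeierstrassCurve.map_b₆, ← h]
    simp
  cases Q with
  | zero => rfl
  | @some x y hxy =>
    exfalso
    have hcubic := fourCubic_eq_zero_of_two_nsmul_eq_zero_field (W.baseChange ℚ_[2]) (x := x) (y := y)
      (h := hxy) (by exact_mod_cast h2Q)
    rw [hb₂, hb₄, hb₆] at hcubic
    exact fourCubic_ne_zero_padic_two p2 p4 p6 x hcubic

/-! ## §3 Lemma 2.3 at `p = 2` -/

/-- **Sprung 2012, Lemma 2.3 AT `p = 2` — `E(ℚ_∞·ℚ₂)[2] = 0` at a good supersingular `2`**: for `W/ℚ`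
elliptic and globally minimal with `GoodSS W 2`, ANY `ℤ₂`-extension `κ` of `ℚ`, the place `v ∋ 2` and ANY
embedding `ι : ℚ̄ → K̄_v`, a point of `E(K̄_v)` fixed by `Gal(K̄_v/ℚ_∞·ℚ_v)` and killed by `2` is `O`.
§1 (Greenberg's principle) + §2 (`E(ℚ₂)[2] = 0`) + the transport `E(ℚ_v)[2] = 0 ⟺ E(ℚ_2)[2] = 0`
(`forall_nsmul_eq_zero_adicCompletion_iff_padic`). This is the displayed input "no `2`-torsion in the
tower" of the ♭ `Γ`-Euler characteristic at `2` (parts 1–3), now a theorem.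
[cite: Sprung2012, Lemma 2.3 (p. 1487), §2 p. 1486 ("we included the prime p = 2")]
[cite: GreenbergLNM1716, proof of Prop. 4.8 (p. 109)] -/
theorem eq_zero_of_mem_localTowerPointsOfEmb_of_two_nsmul (hss : GoodSS W 2)
    (κ : ZpExtension ℚ 2) (hpv : (2 : 𝓞 ℚ) ∈ v.asIdeal)
    (ι : AlgebraicClosure ℚ →ₐ[ℚ] AlgebraicClosure (v.adicCompletion ℚ))
    {P : localPoints W (v.adicCompletion ℚ)} (hPmem : P ∈ localTowerPointsOfEmb κ ι W)
    (hpP : 2 • P = 0) : P = 0 := by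
  have hv0 : ∀ Q : (W.baseChange (v.adicCompletion ℚ)).toAffine.Point, 2 • Q = 0 → Q = 0 :=
    (W.forall_nsmul_eq_zero_adicCompletion_iff_padic (p := 2) (by exact_mod_cast hpv) 2).mpr
      (two_nsmul_eq_zero_padic_of_goodSS_two W hss)
  exact eq_zero_of_mem_localTowerPointsOfEmb_of_prime_nsmul_of_base W 2 hv0 κ ι hPmem hpP

end Summit.BirchSwinnertonDyer.BirchSwinnertonDyer.Theorems.SSFlatEC

end
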